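import Mathlib
import Literature.Probability.Percolation.PercolationProofs
import Literature.Probability.Percolation.CriticalContinuity
import Literature.Probability.Percolation.UniformPercolation
import Literature.Probability.Percolation.KestenTheorem
import Literature.Probability.Percolation.PlanarDuality
import Literature.Probability.LatticeModels.StarLattice
import HarnessLib

/-!
# Crux `PercBurnResprinkle.JumpFireBreak` (stmt-CriticalPhenomena-7204), line `vacant-coins-fresh-spine` — stub `stub_tower`
Helper file for the skeleton `Cruxes/JumpFireBreak/Lines/vacant-coins-fresh-spine.lean` (lead prover-line-stmt-CriticalPhenomena-7204-0);
lands `--supports stmt-CriticalPhenomena-7204`. The tower: scales `(ℓ², ℓ)`, `ℓ = M, M², M⁴, …`; the one-block bound stays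
below `η = δ^{729}`, `δ = 1/(2·28²)`, for `M` large (step error `ψ(ℓ) → 0`) and `ε` small (scale one); at the top a vertex
of an infinite vacant path has a FINITE `p_c`-cluster, so a non-small one is a truncated arm (thin dust + translation invariance).
-/

noncomputable section

namespace Summit.CriticalPhenomena.PercolationContinuityZ3.Theorems

open MeasureTheory ProbabilityTheory Filter Topology Literature.Probability.Percolation Literature.Probability.LatticeModels

attribute [local instance] isProbabilityMeasure_labelMeasure

namespace Tower

/-- **Arm bound.** The `labelMeasure`-probability that the level-`p` cluster of `v` leaves `v + B(r)` but is finite is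
at most `P_p(0 ↔ ∂B(r), |C(0)| < ∞)` (first exit ⇒ translated arm event; translation invariance; `map_configOfLabels`). [folklore] -/
theorem real_notSmall_finite_le (p : unitInterval) (r : ℕ) (v : Fin 3 → ℤ) :
    (labelMeasure (Fin 3 → ℤ)).real
        {U | ¬ openCluster (configOfLabels (p : ℝ) U (zdGraph 3)) v ⊆ {y | y - v ∈ (box 3 r : Set (Fin 3 → ℤ))} ∧
          (openCluster (configOfLabels (p : ℝ) U (zdGraph 3)) v).Finite} ≤
      (bondPercolation (zdGraph 3) p).real (siteToBoundary 3 r \ percolatesAt 0) := by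
  have hmeasE := (measurableSet_zdArmEvent v r).diff (measurableSet_percolatesAt_holds (V := Fin 3 → ℤ) v)
  have hsub : {U : Sym2 (Fin 3 → ℤ) → ℝ |
      ¬ openCluster (configOfLabels (p : ℝ) U (zdGraph 3)) v ⊆ {y | y - v ∈ (box 3 r : Set (Fin 3 → ℤ))} ∧
        (openCluster (configOfLabels (p : ℝ) U (zdGraph 3)) v).Finite} ⊆
      (fun U => configOfLabels (p : ℝ) U (zdGraph 3)) ⁻¹' (DCT16.armEvent v r \ percolatesAt v) := by
    rintro U ⟨hns, hfin⟩
    obtain ⟨z, hz, hzr⟩ := Set.not_subset.1 hns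
    exact ⟨DCT16.armEvent_of_pathIn (fun _ he => he.1) (DCT16.pathIn_univ_of_reachable hz) (Or.inl hzr),
      fun hinf => hinf hfin⟩
  calc (labelMeasure (Fin 3 → ℤ)).real _
      ≤ (labelMeasure (Fin 3 → ℤ)).real
          ((fun U => configOfLabels (p : ℝ) U (zdGraph 3)) ⁻¹' (DCT16.armEvent v r \ percolatesAt v)) :=
        measureReal_mono hsub
    _ = (bondPercolation (zdGraph 3) p).real (DCT16.armEvent v r \ percolatesAt v) := by
        rw [← map_measureReal_apply (measurable_configOfLabels _ _) hmeasE, map_configOfLabels_holds]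
    _ = (bondPercolation (zdGraph 3) p).real (siteToBoundary 3 r \ percolatesAt 0) := by
        rw [real_armEvent_diff_percolatesAt, ← DCT16.armEvent_zero 3 r, real_armEvent_diff_percolatesAt, DCT16.armEvent_zero]

/-- The step's `t`-hypothesis: `μ{¬ small_r v ∧ small_R v} ≤ P_p(0 ↔ ∂B(r), |C| < ∞)` (a small cluster is finite). [folklore] -/
theorem real_notSmall_small_le (p : unitInterval) (r R : ℕ) (v : Fin 3 → ℤ) :
    (labelMeasure (Fin 3 → ℤ)).real
        {U | ¬ openCluster (configOfLabels (p : ℝ) U (zdGraph 3)) v ⊆ {y | y - v ∈ (box 3 r : Set (Fin 3 → ℤ))} ∧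
          openCluster (configOfLabels (p : ℝ) U (zdGraph 3)) v ⊆ {y | y - v ∈ (box 3 R : Set (Fin 3 → ℤ))}} ≤
      (bondPercolation (zdGraph 3) p).real (siteToBoundary 3 r \ percolatesAt 0) := by
  refine le_trans (measureReal_mono ?_) (real_notSmall_finite_le p r v)
  exact fun U hU => ⟨hU.1, ((box 3 R).finite_toSet.preimage fun _ _ _ _ h => sub_left_injective h).subset hU.2⟩

/-- In a walk with at least one edge, every vertex of the support lies on an edge of the walk. [folklore] -/
theorem exists_mem_edges_of_mem_support {V : Type*} {G : SimpleGraph V} :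
    ∀ {u w : V} (q : G.Walk u w), ¬ q.Nil → ∀ z ∈ q.support, ∃ e ∈ q.edges, z ∈ e := by
  intro u w q
  induction q with
  | nil => intro h; exact absurd SimpleGraph.Walk.Nil.nil h
  | @cons a b c hab q ih =>
    intro _ z hz
    rw [SimpleGraph.Walk.support_cons, List.mem_cons] at hz
    rcases hz with rfl | hz
    · exact ⟨s(z, b), by simp, Sym2.mem_mk_left _ _⟩
    · by_cases hq : q.Nil
      · cases hq; exact ⟨s(a, b), by simp, by simp at hz; subst hz; exact Sym2.mem_mk_right _ _⟩
      · obtain ⟨e, he, hze⟩ := ih hq z hz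
        exact ⟨e, by simp [he], hze⟩

/-- **Top-level cover.** An infinite one-field vacant cluster at `x` (level-`q` edges whose endpoints have FINITE level-`p`
clusters) gives, at every scale `(L, r)`, `L ≥ 1`, the bad event at centre `x` or a non-`r`-small finite cluster in `x + B(3L)`. [folklore] -/
theorem cross_or_arm_of_infinite {p q : ℝ} {L r : ℕ} (hL : 1 ≤ L) {x : Fin 3 → ℤ} {U : Sym2 (Fin 3 → ℤ) → ℝ}
    (hinf : (openCluster {e | e ∈ configOfLabels q U (zdGraph 3) ∧
      ∀ y ∈ e, ¬ (openCluster (configOfLabels p U (zdGraph 3)) y).Infinite} x).Infinite) :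
    (∃ a b : Fin 3 → ℤ, a - x ∈ (box 3 L : Set (Fin 3 → ℤ)) ∧ (∃ i, |b i - x i| = 3 * L) ∧
        configOfLabels q U (zdGraph 3) ∈
          openConnIn {v | v - x ∈ (box 3 (3 * L) : Set (Fin 3 → ℤ)) ∧
            openCluster (configOfLabels p U (zdGraph 3)) v ⊆ {y | y - v ∈ (box 3 r : Set (Fin 3 → ℤ))}} a b) ∨
      ∃ v ∈ (box 3 (3 * L)).image (· + x),
        ¬ openCluster (configOfLabels p U (zdGraph 3)) v ⊆ {y | y - v ∈ (box 3 r : Set (Fin 3 → ℤ))} ∧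
          (openCluster (configOfLabels p U (zdGraph 3)) v).Finite := by
  classical
  set vac : BondConfig (Fin 3 → ℤ) := {e | e ∈ configOfLabels q U (zdGraph 3) ∧
      ∀ y ∈ e, ¬ (openCluster (configOfLabels p U (zdGraph 3)) y).Infinite} with hvac_def
  set Λ : Finset (Fin 3 → ℤ) := (box 3 (3 * L)).image (· + x) with hΛ
  have hvacE : vac ⊆ (zdGraph 3).edgeSet := fun _ he => he.1.1
  have hxΛ : x ∈ Λ := Finset.mem_image.2 ⟨0, zero_mem_box 3 _, zero_add x⟩
  obtain ⟨z, hzC, hzΛ⟩ : ∃ z ∈ openCluster vac x, z ∉ Λ := by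
    by_contra hc
    push Not at hc
    exact hinf ((Finset.finite_toSet Λ).subset fun z hz => hc z hz)
  obtain ⟨b, hb, hconn⟩ := exists_mem_innerBoundary_openConnIn hvacE Λ hxΛ hzΛ hzC
  obtain ⟨w, hwS, hwE⟩ := exists_walk_of_mem_openConnIn hvacE hconn
  rw [hΛ, innerBoundary_image_add_right] at hb
  obtain ⟨b₀, hb₀, rfl⟩ := Finset.mem_image.1 hb
  obtain ⟨i, hi⟩ := exists_eq_of_mem_innerBoundary_box hb₀
  have hbi : |(b₀ + x) i - x i| = 3 * L := by
    simp only [Pi.add_apply, add_sub_cancel_right]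
    rcases hi with h | h <;> rw [h] <;> push_cast <;> simp [abs_of_nonneg]
  have hnil : ¬ w.Nil := by
    intro hn
    have h0 : b₀ = 0 := by simpa using (SimpleGraph.Walk.Nil.eq hn).symm
    have : b₀ i = 0 := by rw [h0]; rfl
    have hL' : (1 : ℤ) ≤ L := by exact_mod_cast hL
    rcases hi with h | h <;> omega
  by_cases hall : ∀ v ∈ w.support,
      openCluster (configOfLabels p U (zdGraph 3)) v ⊆ {y | y - v ∈ (box 3 r : Set (Fin 3 → ℤ))}
  · refine Or.inl ⟨x, b₀ + x, by rw [sub_self]; exact zero_mem_box 3 L, ⟨i, hbi⟩, ?_⟩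
    refine mem_openConnIn_of_walk w (fun v hv => ⟨?_, hall v hv⟩) (fun e he => (hwE e he).1)
    have hv := hwS v hv
    rw [hΛ, Finset.mem_coe, Finset.mem_image] at hv
    obtain ⟨v₀, hv₀, rfl⟩ := hv
    simpa using hv₀
  · push Not at hall
    obtain ⟨v, hv, hnv⟩ := hall
    obtain ⟨e, he, hve⟩ := exists_mem_edges_of_mem_support w hnil v hv
    exact Or.inr ⟨v, hwS v hv, hnv, Set.not_infinite.1 ((hwE e he).2 v hve)⟩

/-- **Top-level bound.** `μ{x percolates vacantly} ≤ μ{bad event at (L, r) centred at x} + (6L+1)³ · P_p(0 ↔ ∂B(r), |C| < ∞)`. [folklore] -/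
theorem real_percolates_le (p : unitInterval) (q : ℝ) {L : ℕ} (hL : 1 ≤ L) (r : ℕ) (x : Fin 3 → ℤ) :
    (labelMeasure (Fin 3 → ℤ)).real {U | (openCluster {e | e ∈ configOfLabels q U (zdGraph 3) ∧
        ∀ y ∈ e, ¬ (openCluster (configOfLabels (p : ℝ) U (zdGraph 3)) y).Infinite} x).Infinite} ≤
      (labelMeasure (Fin 3 → ℤ)).real
        {U | ∃ a b : Fin 3 → ℤ, a - x ∈ (box 3 L : Set (Fin 3 → ℤ)) ∧ (∃ i, |b i - x i| = 3 * L) ∧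
          configOfLabels q U (zdGraph 3) ∈
            openConnIn {v | v - x ∈ (box 3 (3 * L) : Set (Fin 3 → ℤ)) ∧
              openCluster (configOfLabels (p : ℝ) U (zdGraph 3)) v ⊆ {y | y - v ∈ (box 3 r : Set (Fin 3 → ℤ))}} a b} +
      (6 * (L : ℝ) + 1) ^ 3 * (bondPercolation (zdGraph 3) p).real (siteToBoundary 3 r \ percolatesAt 0) := by
  classical
  set μ := labelMeasure (Fin 3 → ℤ)
  set Λ : Finset (Fin 3 → ℤ) := (box 3 (3 * L)).image (· + x) with hΛ
  set F : (Fin 3 → ℤ) → Set (Sym2 (Fin 3 → ℤ) → ℝ) := fun v =>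
    {U | ¬ openCluster (configOfLabels (p : ℝ) U (zdGraph 3)) v ⊆ {y | y - v ∈ (box 3 r : Set (Fin 3 → ℤ))} ∧
      (openCluster (configOfLabels (p : ℝ) U (zdGraph 3)) v).Finite} with hF
  set S : Set (Sym2 (Fin 3 → ℤ) → ℝ) := {U | (openCluster {e | e ∈ configOfLabels q U (zdGraph 3) ∧
        ∀ y ∈ e, ¬ (openCluster (configOfLabels (p : ℝ) U (zdGraph 3)) y).Infinite} x).Infinite} with hS
  set B : Set (Sym2 (Fin 3 → ℤ) → ℝ) :=
    {U | ∃ a b : Fin 3 → ℤ, a - x ∈ (box 3 L : Set (Fin 3 → ℤ)) ∧ (∃ i, |b i - x i| = 3 * L) ∧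
      configOfLabels q U (zdGraph 3) ∈
        openConnIn {v | v - x ∈ (box 3 (3 * L) : Set (Fin 3 → ℤ)) ∧
          openCluster (configOfLabels (p : ℝ) U (zdGraph 3)) v ⊆ {y | y - v ∈ (box 3 r : Set (Fin 3 → ℤ))}} a b}
    with hB
  have hcover : S ⊆ B ∪ ⋃ v ∈ Λ, F v := fun U hU =>
    (cross_or_arm_of_infinite (p := (p : ℝ)) (q := q) (r := r) hL hU).imp id fun ⟨v, hv, h⟩ =>
      Set.mem_iUnion₂.2 ⟨v, hv, h⟩
  have hcard : (Λ.card : ℝ) ≤ (6 * (L : ℝ) + 1) ^ 3 := by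
    have h2 : (Λ.card : ℝ) ≤ ((2 * (3 * L) + 1) ^ 3 : ℕ) := by exact_mod_cast (card_box 3 (3 * L)) ▸ Finset.card_image_le
    exact h2.trans (le_of_eq (by push_cast; ring))
  calc μ.real S ≤ μ.real (B ∪ ⋃ v ∈ Λ, F v) := measureReal_mono hcover
    _ ≤ μ.real B + ∑ v ∈ Λ, μ.real (F v) :=
        (measureReal_union_le _ _).trans (by gcongr; exact measureReal_biUnion_finset_le _ _)
    _ ≤ μ.real B + ∑ _v ∈ Λ, (bondPercolation (zdGraph 3) p).real (siteToBoundary 3 r \ percolatesAt 0) := by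
        gcongr with v
        exact real_notSmall_finite_le p r v
    _ ≤ μ.real B + (6 * (L : ℝ) + 1) ^ 3 * (bondPercolation (zdGraph 3) p).real (siteToBoundary 3 r \ percolatesAt 0) := by
        rw [Finset.sum_const, nsmul_eq_mul]
        gcongr

/-- Scale one can be made small: for `M ≥ 1`, `η > 0` some `ε ∈ (0, 1]` has `(2M²+1)³ (6(2M+1)³ ε)^M ≤ η`. [folklore] -/
theorem exists_eps_small {M : ℕ} (hM : 1 ≤ M) {η : ℝ} (hη : 0 < η) :
    ∃ ε : ℝ, 0 < ε ∧ ε ≤ 1 ∧ (2 * (M : ℝ) ^ 2 + 1) ^ 3 * (6 * (2 * (M : ℝ) + 1) ^ 3 * ε) ^ M ≤ η := by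
  set D : ℝ := (2 * (M : ℝ) ^ 2 + 1) ^ 3 * (6 * (2 * (M : ℝ) + 1) ^ 3) ^ M with hD
  have hDpos : 0 < D := by positivity
  have hε0 : 0 < min 1 (η / D) := lt_min one_pos (div_pos hη hDpos)
  refine ⟨min 1 (η / D), hε0, min_le_left _ _, ?_⟩
  calc (2 * (M : ℝ) ^ 2 + 1) ^ 3 * (6 * (2 * (M : ℝ) + 1) ^ 3 * min 1 (η / D)) ^ M
      = D * (min 1 (η / D)) ^ M := by rw [hD, mul_pow]; ring
    _ ≤ D * min 1 (η / D) :=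
        mul_le_mul_of_nonneg_left (by simpa using pow_le_pow_of_le_one hε0.le (min_le_left _ _) hM) hDpos.le
    _ ≤ D * (η / D) := mul_le_mul_of_nonneg_left (min_le_right _ _) hDpos.le
    _ = η := mul_div_cancel₀ η hDpos.ne'

/-- The step's Peierls constant tends to zero (`A = 3³+1`, `δ = (2A²)⁻¹`): it is `≤ 27 δ^{-733} n³ 4^{-n}` for `n ≥ 367`. [folklore] -/
theorem tendsto_stepConst :
    Tendsto (fun n : ℕ => (2 * (n : ℝ) + 1) ^ 3 *
      ((((3 : ℝ) ^ 3 + 1) ^ (2 * ((2 * n - 5) - 1))) *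
        ((2 * ((3 : ℝ) ^ 3 + 1) ^ 2)⁻¹) ^ ((2 * n - 5) - ((8 + 1) ^ 3 - 1)))) atTop (𝓝 0) := by
  set A : ℝ := (3 : ℝ) ^ 3 + 1 with hA
  set δ : ℝ := (2 * A ^ 2)⁻¹ with hδ
  have hA1 : 1 ≤ A := by norm_num [hA]
  have hδpos : 0 < δ := by positivity
  have hAδ : A ^ 4 * δ ^ 2 = 1 / 4 := by rw [hδ, hA]; norm_num
  have h728 : (8 + 1) ^ 3 - 1 = 728 := by norm_num
  have hg : Tendsto (fun n : ℕ => 27 * (δ ^ 733)⁻¹ * ((n : ℝ) ^ 3 * (1 / 4 : ℝ) ^ n)) atTop (𝓝 0) := by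
    simpa using (tendsto_pow_const_mul_const_pow_of_lt_one 3 (by norm_num : (0 : ℝ) ≤ 1 / 4)
      (by norm_num : (1 / 4 : ℝ) < 1)).const_mul (27 * (δ ^ 733)⁻¹)
  refine squeeze_zero' (Eventually.of_forall fun n => by positivity) ?_ hg
  filter_upwards [eventually_ge_atTop 367] with n hn
  rw [h728]
  have e1 : (2 * n - 5) - 728 = 2 * n - 733 := by omega
  have hpowA : A ^ (2 * ((2 * n - 5) - 1)) ≤ A ^ (4 * n) := pow_le_pow_right₀ hA1 (by omega)
  have hpowδ : δ ^ ((2 * n - 5) - 728) = δ ^ (2 * n) * (δ ^ 733)⁻¹ := by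
    rw [e1, pow_sub₀ _ hδpos.ne' (by omega)]
  have hmain : A ^ (4 * n) * (δ ^ (2 * n) * (δ ^ 733)⁻¹) = (δ ^ 733)⁻¹ * (1 / 4 : ℝ) ^ n := by
    rw [show A ^ (4 * n) = (A ^ 4) ^ n by rw [pow_mul], show δ ^ (2 * n) = (δ ^ 2) ^ n by rw [pow_mul],
      ← hAδ, mul_pow]
    ac_rfl
  have hpoly : (2 * (n : ℝ) + 1) ^ 3 ≤ 27 * (n : ℝ) ^ 3 := by
    have hn1 : (1 : ℝ) ≤ n := by exact_mod_cast (show 1 ≤ n by omega)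
    calc (2 * (n : ℝ) + 1) ^ 3 ≤ (3 * (n : ℝ)) ^ 3 := by gcongr; linarith
      _ = 27 * (n : ℝ) ^ 3 := by ring
  calc (2 * (n : ℝ) + 1) ^ 3 * (A ^ (2 * ((2 * n - 5) - 1)) * δ ^ ((2 * n - 5) - 728))
      ≤ (27 * (n : ℝ) ^ 3) * (A ^ (4 * n) * (δ ^ (2 * n) * (δ ^ 733)⁻¹)) := by rw [hpowδ]; gcongr
    _ = 27 * (δ ^ 733)⁻¹ * ((n : ℝ) ^ 3 * (1 / 4 : ℝ) ^ n) := by rw [hmain]; ac_rfl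

/-- Polynomial prefactors are absorbed by arm decay of order `13`: `a³ · C/(ℓ+1)^{13} ≤ 343 C/(ℓ+1)` for `0 ≤ a ≤ 7(ℓ+1)⁴`. [folklore] -/
theorem cube_mul_div_le {a C : ℝ} {ℓ : ℕ} (ha0 : 0 ≤ a) (ha : a ≤ 7 * ((ℓ : ℝ) + 1) ^ 4) (hC : 0 ≤ C) :
    a ^ 3 * (C / ((ℓ : ℝ) + 1) ^ 13) ≤ 343 * C / ((ℓ : ℝ) + 1) := by
  have hl : (0 : ℝ) < (ℓ : ℝ) + 1 := by positivity
  have h3 : a ^ 3 ≤ 343 * ((ℓ : ℝ) + 1) ^ 12 := (pow_le_pow_left₀ ha0 ha 3).trans (le_of_eq (by ring))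
  calc a ^ 3 * (C / ((ℓ : ℝ) + 1) ^ 13) ≤ 343 * ((ℓ : ℝ) + 1) ^ 12 * (C / ((ℓ : ℝ) + 1) ^ 13) := by gcongr
    _ = 343 * C / ((ℓ : ℝ) + 1) := by field_simp

end Tower

/-- Registered stub `stub_tower` of crux stmt-CriticalPhenomena-7204 (line vacant-coins-fresh-spine); see the line
skeleton `Cruxes/JumpFireBreak/Lines/vacant-coins-fresh-spine.lean` for the informal statement and sources. -/
theorem stub_tower :
    (∀ (M : ℕ), 1 ≤ M → ∀ (ε : ℝ), 0 ≤ ε → ∀ (c : Fin 3 → ℤ),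
        (labelMeasure (Fin 3 → ℤ)).real
            {U | ∃ a b : Fin 3 → ℤ, a - c ∈ (box 3 (M ^ 2) : Set (Fin 3 → ℤ)) ∧ (∃ i, |b i - c i| = 3 * M ^ 2) ∧
              configOfLabels (criticalProb (zdGraph 3) (0 : Fin 3 → ℤ) + ε) U (zdGraph 3) ∈
                openConnIn {v | v - c ∈ (box 3 (3 * M ^ 2) : Set (Fin 3 → ℤ)) ∧
                  openCluster (configOfLabels (criticalProb (zdGraph 3) (0 : Fin 3 → ℤ)) U (zdGraph 3)) v ⊆
                    {y | y - v ∈ (box 3 M : Set (Fin 3 → ℤ))}} a b} ≤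
          (2 * (M : ℝ) ^ 2 + 1) ^ 3 * (6 * (2 * (M : ℝ) + 1) ^ 3 * ε) ^ M) →
    (∀ (L r : ℕ), 3 ≤ L → r ≤ L → ∀ (q : ℝ) (c : Fin 3 → ℤ) (δ : ℝ), 0 ≤ δ → δ ≤ 1 →
        (∀ c' : Fin 3 → ℤ, (labelMeasure (Fin 3 → ℤ)).real
            {U | ∃ a b : Fin 3 → ℤ, a - c' ∈ (box 3 L : Set (Fin 3 → ℤ)) ∧ (∃ i, |b i - c' i| = 3 * L) ∧
              configOfLabels q U (zdGraph 3) ∈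
                openConnIn {v | v - c' ∈ (box 3 (3 * L) : Set (Fin 3 → ℤ)) ∧
                  openCluster (configOfLabels (criticalProb (zdGraph 3) (0 : Fin 3 → ℤ)) U (zdGraph 3)) v ⊆
                    {y | y - v ∈ (box 3 r : Set (Fin 3 → ℤ))}} a b} ≤ δ ^ ((8 + 1) ^ 3)) →
        ∀ T : Finset (Fin 3 → ℤ), (∀ x ∈ T, ∀ y ∈ T, x ≠ y → 8 < supDist x y) →
          (labelMeasure (Fin 3 → ℤ)).real (⋂ b ∈ T,
            {U | ∃ a b' : Fin 3 → ℤ, a - (c + (L : ℤ) • b) ∈ (box 3 L : Set (Fin 3 → ℤ)) ∧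
              (∃ i, |b' i - (c + (L : ℤ) • b) i| = 3 * L) ∧
              configOfLabels q U (zdGraph 3) ∈
                openConnIn {v | v - (c + (L : ℤ) • b) ∈ (box 3 (3 * L) : Set (Fin 3 → ℤ)) ∧
                  openCluster (configOfLabels (criticalProb (zdGraph 3) (0 : Fin 3 → ℤ)) U (zdGraph 3)) v ⊆
                    {y | y - v ∈ (box 3 r : Set (Fin 3 → ℤ))}} a b'}) ≤ δ ^ ((8 + 1) ^ 3 * T.card)) →
    (∀ (L r : ℕ), 3 ≤ L → r ≤ L → ∀ (q : ℝ) (c : Fin 3 → ℤ) (δ t : ℝ), 0 ≤ δ → δ ≤ 1 → 0 ≤ t →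
        (∀ T : Finset (Fin 3 → ℤ), (∀ x ∈ T, ∀ y ∈ T, x ≠ y → 8 < supDist x y) →
          (labelMeasure (Fin 3 → ℤ)).real (⋂ b ∈ T,
            {U | ∃ a b' : Fin 3 → ℤ, a - (c + (L : ℤ) • b) ∈ (box 3 L : Set (Fin 3 → ℤ)) ∧
              (∃ i, |b' i - (c + (L : ℤ) • b) i| = 3 * L) ∧
              configOfLabels q U (zdGraph 3) ∈
                openConnIn {v | v - (c + (L : ℤ) • b) ∈ (box 3 (3 * L) : Set (Fin 3 → ℤ)) ∧
                  openCluster (configOfLabels (criticalProb (zdGraph 3) (0 : Fin 3 → ℤ)) U (zdGraph 3)) v ⊆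
                    {y | y - v ∈ (box 3 r : Set (Fin 3 → ℤ))}} a b'}) ≤ δ ^ ((8 + 1) ^ 3 * T.card)) →
        (∀ v : Fin 3 → ℤ, (labelMeasure (Fin 3 → ℤ)).real
            {U | ¬ openCluster (configOfLabels (criticalProb (zdGraph 3) (0 : Fin 3 → ℤ)) U (zdGraph 3)) v ⊆
                  {y | y - v ∈ (box 3 r : Set (Fin 3 → ℤ))} ∧
                openCluster (configOfLabels (criticalProb (zdGraph 3) (0 : Fin 3 → ℤ)) U (zdGraph 3)) v ⊆
                  {y | y - v ∈ (box 3 L : Set (Fin 3 → ℤ))}} ≤ t) →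
        (labelMeasure (Fin 3 → ℤ)).real
            {U | ∃ a b : Fin 3 → ℤ, a - c ∈ (box 3 (L ^ 2) : Set (Fin 3 → ℤ)) ∧ (∃ i, |b i - c i| = 3 * L ^ 2) ∧
              configOfLabels q U (zdGraph 3) ∈
                openConnIn {v | v - c ∈ (box 3 (3 * L ^ 2) : Set (Fin 3 → ℤ)) ∧
                  openCluster (configOfLabels (criticalProb (zdGraph 3) (0 : Fin 3 → ℤ)) U (zdGraph 3)) v ⊆
                    {y | y - v ∈ (box 3 L : Set (Fin 3 → ℤ))}} a b} ≤
          (2 * (L : ℝ) + 1) ^ 3 * (((3 : ℝ) ^ 3 + 1) ^ (2 * ((2 * L - 5) - 1)) * δ ^ ((2 * L - 5) - ((8 + 1) ^ 3 - 1))) +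
            (6 * (L : ℝ) ^ 2 + 1) ^ 3 * t) →
    (∀ k : ℕ, ∃ C : ℝ, ∀ n : ℕ,
      (bondPercolation (zdGraph 3) (criticalProbI 3)).real (siteToBoundary 3 n \ percolatesAt 0) ≤
        C / ((n : ℝ) + 1) ^ k) →
    ∃ ε : ℝ, 0 < ε ∧
      (labelMeasure (Fin 3 → ℤ))
        {U | ∃ x : Fin 3 → ℤ, (openCluster {e | e ∈ configOfLabels (criticalProb (zdGraph 3) (0 : Fin 3 → ℤ) + ε) U
          (zdGraph 3) ∧ ∀ y ∈ e, ¬ (openCluster (configOfLabels (criticalProb (zdGraph 3) (0 : Fin 3 → ℤ)) U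
          (zdGraph 3)) y).Infinite} x).Infinite} = 0 := by
  intro h1 h5 h6 hd
  classical
  set A : ℝ := (3 : ℝ) ^ 3 + 1 with hA
  set δ : ℝ := (2 * A ^ 2)⁻¹ with hδ
  have hA28 : A = 28 := by rw [hA]; norm_num
  have hδpos : 0 < δ := by rw [hδ, hA28]; norm_num
  have hδ0 : 0 ≤ δ := hδpos.le
  have hδ1 : δ ≤ 1 := by rw [hδ, hA28]; norm_num
  set η : ℝ := δ ^ ((8 + 1) ^ 3) with hη
  have hη0 : 0 < η := by positivity
  obtain ⟨C, hC⟩ := hd 13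
  have hC0 : 0 ≤ C := by simpa using measureReal_nonneg.trans (hC 0)
  set μ := labelMeasure (Fin 3 → ℤ) with hμ
  set pc : ℝ := criticalProb (zdGraph 3) (0 : Fin 3 → ℤ) with hpc
  set t : ℕ → ℝ := fun r =>
    (bondPercolation (zdGraph 3) (criticalProbI 3)).real (siteToBoundary 3 r \ percolatesAt 0) with ht
  set Cr : ℕ → ℕ → ℝ → (Fin 3 → ℤ) → Set (Sym2 (Fin 3 → ℤ) → ℝ) := fun L r q c =>
    {U | ∃ a b : Fin 3 → ℤ, a - c ∈ (box 3 L : Set (Fin 3 → ℤ)) ∧ (∃ i, |b i - c i| = 3 * L) ∧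
      configOfLabels q U (zdGraph 3) ∈
        openConnIn {v | v - c ∈ (box 3 (3 * L) : Set (Fin 3 → ℤ)) ∧
          openCluster (configOfLabels pc U (zdGraph 3)) v ⊆ {y | y - v ∈ (box 3 r : Set (Fin 3 → ℤ))}} a b}
    with hCr
  set ψ : ℕ → ℝ := fun ℓ => (2 * ((ℓ ^ 2 : ℕ) : ℝ) + 1) ^ 3 *
      (A ^ (2 * ((2 * ℓ ^ 2 - 5) - 1)) * δ ^ ((2 * ℓ ^ 2 - 5) - ((8 + 1) ^ 3 - 1))) +
      (6 * ((ℓ ^ 2 : ℕ) : ℝ) ^ 2 + 1) ^ 3 * t ℓ with hψ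
  have ht0 : ∀ r, 0 ≤ t r := fun r => measureReal_nonneg
  have hstep : ∀ ℓ : ℕ, 2 ≤ ℓ → ∀ q : ℝ, (∀ c, μ.real (Cr (ℓ ^ 2) ℓ q c) ≤ η) →
      ∀ c, μ.real (Cr ((ℓ ^ 2) ^ 2) (ℓ ^ 2) q c) ≤ ψ ℓ := by
    intro ℓ hℓ q hB c
    have hL3 : 3 ≤ ℓ ^ 2 := by nlinarith
    have hrL : ℓ ≤ ℓ ^ 2 := by nlinarith
    have htv : ∀ v : Fin 3 → ℤ, μ.real
        {U | ¬ openCluster (configOfLabels pc U (zdGraph 3)) v ⊆ {y | y - v ∈ (box 3 ℓ : Set (Fin 3 → ℤ))} ∧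
          openCluster (configOfLabels pc U (zdGraph 3)) v ⊆ {y | y - v ∈ (box 3 (ℓ ^ 2) : Set (Fin 3 → ℤ))}} ≤
        t ℓ := fun v => Tower.real_notSmall_small_le (criticalProbI 3) ℓ (ℓ ^ 2) v
    exact h6 (ℓ ^ 2) ℓ hL3 hrL q c δ (t ℓ) hδ0 hδ1 (ht0 ℓ) (h5 (ℓ ^ 2) ℓ hL3 hrL q c δ hδ0 hδ1 hB) htv
  have hsmall : ∀ κ : ℝ, 0 < κ → ∃ N : ℕ, ∀ ℓ : ℕ, N ≤ ℓ →
      ψ ℓ ≤ κ ∧ (6 * ((ℓ ^ 2 : ℕ) : ℝ) + 1) ^ 3 * t ℓ ≤ κ := by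
    intro κ hκ
    have hT1 : Tendsto (fun ℓ : ℕ => (2 * ((ℓ ^ 2 : ℕ) : ℝ) + 1) ^ 3 *
        (A ^ (2 * ((2 * ℓ ^ 2 - 5) - 1)) * δ ^ ((2 * ℓ ^ 2 - 5) - ((8 + 1) ^ 3 - 1)))) atTop (𝓝 0) :=
      Tower.tendsto_stepConst.comp (tendsto_atTop_mono (fun ℓ => Nat.le_self_pow two_ne_zero ℓ) tendsto_id)
    obtain ⟨N₁, hN₁⟩ := eventually_atTop.1 (hT1.eventually (Iio_mem_nhds (half_pos hκ)))
    obtain ⟨N₂, hN₂⟩ := exists_nat_ge (343 * C * 2 / κ)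
    refine ⟨max N₁ N₂, fun ℓ hℓ => ?_⟩
    have hℓ2 : (N₂ : ℝ) ≤ ℓ := by exact_mod_cast (le_max_right _ _).trans hℓ
    have hl : (0 : ℝ) < (ℓ : ℝ) + 1 := by positivity
    have hquot : 343 * C / ((ℓ : ℝ) + 1) ≤ κ / 2 := by
      rw [div_le_iff₀ hl]
      have : 343 * C * 2 / κ ≤ (ℓ : ℝ) + 1 := by linarith
      rw [div_le_iff₀ hκ] at this
      linarith
    have hone : (1 : ℝ) ≤ ((ℓ : ℝ) + 1) ^ 4 := one_le_pow₀ (by linarith)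
    have hpow4 : ((ℓ ^ 2 : ℕ) : ℝ) ^ 2 ≤ ((ℓ : ℝ) + 1) ^ 4 := by
      push_cast
      nlinarith [sq_nonneg (ℓ : ℝ), pow_le_pow_left₀ (Nat.cast_nonneg ℓ) (by linarith : (ℓ : ℝ) ≤ ℓ + 1) 4]
    have hsq1 : ((ℓ ^ 2 : ℕ) : ℝ) ≤ ((ℓ ^ 2 : ℕ) : ℝ) ^ 2 := by
      rcases Nat.eq_zero_or_pos ℓ with h0 | hpos
      · subst h0; simp
      · have : (1 : ℝ) ≤ ((ℓ ^ 2 : ℕ) : ℝ) := by exact_mod_cast Nat.one_le_pow _ _ hpos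
        nlinarith
    have hT2 : (6 * ((ℓ ^ 2 : ℕ) : ℝ) ^ 2 + 1) ^ 3 * t ℓ ≤ κ / 2 :=
      calc (6 * ((ℓ ^ 2 : ℕ) : ℝ) ^ 2 + 1) ^ 3 * t ℓ
          ≤ (6 * ((ℓ ^ 2 : ℕ) : ℝ) ^ 2 + 1) ^ 3 * (C / ((ℓ : ℝ) + 1) ^ 13) := by gcongr; exact hC ℓ
        _ ≤ 343 * C / ((ℓ : ℝ) + 1) := Tower.cube_mul_div_le (by positivity) (by nlinarith) hC0
        _ ≤ κ / 2 := hquot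
    have hT3 : (6 * ((ℓ ^ 2 : ℕ) : ℝ) + 1) ^ 3 * t ℓ ≤ κ / 2 :=
      le_trans (by gcongr) hT2
    refine ⟨?_, hT3.trans (by linarith)⟩
    simp only [hψ]
    exact (add_le_add (hN₁ ℓ ((le_max_left _ _).trans hℓ)).le hT2).trans (le_of_eq (add_halves κ))
  obtain ⟨M₀, hM₀⟩ := hsmall η hη0
  set M : ℕ := max M₀ 2 with hMdef
  have hM2 : 2 ≤ M := le_max_right _ _
  have hM1 : 1 ≤ M := le_trans one_le_two hM2
  obtain ⟨ε, hε0, -, hεb⟩ := Tower.exists_eps_small hM1 hη0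
  have hbase : ∀ c, μ.real (Cr (M ^ 2) M (pc + ε) c) ≤ η := fun c => (h1 M hM1 ε hε0.le c).trans hεb
  have hℓsq : ∀ k : ℕ, (M ^ 2 ^ k) ^ 2 = M ^ 2 ^ (k + 1) := fun k => by rw [← pow_mul, ← pow_succ]
  have hℓge : ∀ k : ℕ, M ≤ M ^ 2 ^ k := fun k => Nat.le_self_pow (pow_ne_zero k two_ne_zero) M
  have hP : ∀ k : ℕ, (∀ c, μ.real (Cr ((M ^ 2 ^ k) ^ 2) (M ^ 2 ^ k) (pc + ε) c) ≤ η) ∧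
      (∀ c, μ.real (Cr ((M ^ 2 ^ (k + 1)) ^ 2) (M ^ 2 ^ (k + 1)) (pc + ε) c) ≤ ψ (M ^ 2 ^ k)) := by
    intro k
    induction k with
    | zero =>
      rw [show M ^ 2 ^ 0 = M by simp, show M ^ 2 ^ (0 + 1) = M ^ 2 by simp]
      exact ⟨hbase, hstep M hM2 _ hbase⟩
    | succ k ih =>
      have hPk : ∀ c, μ.real (Cr ((M ^ 2 ^ (k + 1)) ^ 2) (M ^ 2 ^ (k + 1)) (pc + ε) c) ≤ η :=
        fun c => (ih.2 c).trans (hM₀ _ ((le_max_left _ _).trans (hℓge k))).1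
      refine ⟨hPk, fun c => ?_⟩
      have := hstep (M ^ 2 ^ (k + 1)) (hM2.trans (hℓge (k + 1))) _ hPk c
      rwa [hℓsq (k + 1)] at this
  refine ⟨ε, hε0, ?_⟩
  have hx0 : ∀ x : Fin 3 → ℤ, μ {U | (openCluster {e | e ∈ configOfLabels (pc + ε) U (zdGraph 3) ∧
      ∀ y ∈ e, ¬ (openCluster (configOfLabels pc U (zdGraph 3)) y).Infinite} x).Infinite} = 0 := by
    intro x
    rw [← measureReal_eq_zero_iff]
    refine le_antisymm (le_of_forall_pos_le_add fun κ hκ => ?_) measureReal_nonneg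
    obtain ⟨N, hN⟩ := hsmall (κ / 2) (half_pos hκ)
    have hkN : N ≤ M ^ 2 ^ N :=
      calc N ≤ 2 ^ N := (Nat.lt_two_pow_self).le
        _ ≤ 2 ^ 2 ^ N := Nat.pow_le_pow_right two_pos (Nat.lt_two_pow_self).le
        _ ≤ M ^ 2 ^ N := Nat.pow_le_pow_left hM2 _
    set ℓ : ℕ := M ^ 2 ^ (N + 1) with hℓdef
    have hℓN : N ≤ ℓ := hkN.trans (by rw [hℓdef, ← hℓsq N]; exact Nat.le_self_pow two_ne_zero _)
    have hQ := (hP N).2 x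
    rw [← hℓdef] at hQ
    calc μ.real _ ≤ μ.real (Cr (ℓ ^ 2) ℓ (pc + ε) x) + (6 * ((ℓ ^ 2 : ℕ) : ℝ) + 1) ^ 3 * t ℓ :=
          Tower.real_percolates_le (criticalProbI 3) (pc + ε) (Nat.one_le_pow _ _ (by positivity)) ℓ x
      _ ≤ κ / 2 + κ / 2 := add_le_add (hQ.trans (hN (M ^ 2 ^ N) hkN).1) (hN ℓ hℓN).2
      _ = 0 + κ := by ring
  refine measure_mono_null (fun U hU => ?_) (measure_iUnion_null hx0)
  obtain ⟨x, hx⟩ := hU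
  exact Set.mem_iUnion.2 ⟨x, hx⟩

end Summit.CriticalPhenomena.PercolationContinuityZ3.Theorems

end
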